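import Summits.RiemannHypothesis.RiemannHypothesis.Theorems.LaplaceLoophole.Negative.LaplaceLoopholeThetaCertificate

/-!
# RiemannHypothesis / UniversalFactor — the theta series `Φ_ℂ(iy)` changes sign on `(0.31, 0.33)`
(negative-side support for crux `LaplaceLoophole`, item stmt-RiemannHypothesis-2575)

Sequel of `LaplaceLoopholeThetaCertificate.lean` (kernel certificates `checkPos_031`, `checkNeg_033` for
the first twelve terms). Here: the crude tail bound `Σ_{m≥13} ‖s_m(y)‖ ≤ 1/100` for `cos 4y ≥ 1/5`
(`tsum_norm_term_tail_le`; `‖s_m‖ ≤ 30e^{−4m}`), and the sign theorems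

  `UniversalFactor.PhiICert.re_tsum_pos_031 : 0 < Re Σ_{m≥1} s_m(0.31)`,
  `UniversalFactor.PhiICert.re_tsum_neg_033 : Re Σ_{m≥1} s_m(0.33) < 0`,

with `s_m(y) = (2π²m⁴e^{9iy} − 3πm²e^{5iy}) exp(−πm²e^{4iy})` (`UniversalFactor.PhiICert.term`) the terms
of `Φ_ℂ(iy)`. With `∫₀^∞ H_0 cosh(a·) = (π/2)Φ_ℂ(ia)` this pins a zero of the wide-window residue in
`(0.31, 0.33)` (numerically `a₀ = 0.3194150268…`, unique on `(0, π/8)`).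
-/

noncomputable section

namespace Summit.RiemannHypothesis.RiemannHypothesis.Theorems

open Literature.Analysis.ValidatedNumerics.Numerics
open Complex Real Finset

namespace UniversalFactor.PhiICert

/-! ## The tail `m ≥ 13`: `Σ_{m≥13} ‖s_m(y)‖ ≤ 1/100` whenever `cos 4y ≥ 1/5` -/

/-- `‖s_m(y)‖ ≤ (2π²m⁴ + 3πm²) e^{−πm² cos 4y}`. [folklore] -/
theorem norm_term_le (m : ℕ) (y : ℝ) :
    ‖term m y‖ ≤ (2 * π ^ 2 * (m : ℝ) ^ 4 + 3 * π * (m : ℝ) ^ 2) *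
      Real.exp (-(π * (m : ℝ) ^ 2 * Real.cos (4 * y))) := by
  have h9 : ‖cexp (9 * (I * y))‖ = 1 := by rw [Complex.norm_exp]; simp
  have h5 : ‖cexp (5 * (I * y))‖ = 1 := by rw [Complex.norm_exp]; simp
  have hm : ‖(m : ℂ)‖ = (m : ℝ) := by simp
  have hG : ‖cexp (-(π * (m : ℂ) ^ 2 * cexp (4 * (I * y))))‖ =
      Real.exp (-(π * (m : ℝ) ^ 2 * Real.cos (4 * y))) := by
    rw [Complex.norm_exp]
    congr 1
    have e1 : (π : ℂ) * (m : ℂ) ^ 2 = ((π * (m : ℝ) ^ 2 : ℝ) : ℂ) := by push_cast; ring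
    have e2 : (cexp (4 * (I * (y : ℂ)))).re = Real.cos (4 * y) := by
      rw [show (4 * (I * (y : ℂ))) = ((4 * y : ℝ) : ℂ) * I by push_cast; ring, Complex.exp_ofReal_mul_I_re]
    rw [neg_re, e1, Complex.re_ofReal_mul, e2]
  have hP : ‖2 * (π : ℂ) ^ 2 * (m : ℂ) ^ 4 * cexp (9 * (I * y)) - 3 * π * (m : ℂ) ^ 2 * cexp (5 * (I * y))‖ ≤
      2 * π ^ 2 * (m : ℝ) ^ 4 + 3 * π * (m : ℝ) ^ 2 := by
    refine (norm_sub_le _ _).trans (le_of_eq ?_)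
    simp only [norm_mul, norm_pow, hm, h9, h5, Complex.norm_real, Real.norm_eq_abs,
      abs_of_pos Real.pi_pos, Complex.norm_ofNat, mul_one]
  rw [term, norm_mul, hG]
  exact mul_le_mul_of_nonneg_right hP (Real.exp_pos _).le

/-- For `m ≥ 13` and `cos 4y ≥ 1/5`: `‖s_m(y)‖ ≤ 30 e^{−4m}` (crude: `2π² + 3π ≤ 30`,
`m⁴ ≤ e^{4(m−1)}`, `(π/5)m² ≥ 8m`). [folklore] -/
theorem norm_term_le_of_cos {m : ℕ} (hm : 13 ≤ m) {y : ℝ} (hc : 1 / 5 ≤ Real.cos (4 * y)) :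
    ‖term m y‖ ≤ 30 * Real.exp (-4 * (m : ℝ)) := by
  have hm' : (13 : ℝ) ≤ m := by exact_mod_cast hm
  have hπ := Real.pi_gt_d2
  have hπ' := Real.pi_lt_d2
  refine (norm_term_le m y).trans ?_
  -- polynomial factor
  have h1 : 2 * π ^ 2 * (m : ℝ) ^ 4 + 3 * π * (m : ℝ) ^ 2 ≤ 30 * (m : ℝ) ^ 4 := by
    have hm2 : (m : ℝ) ^ 2 ≤ (m : ℝ) ^ 4 := by
      have : (1 : ℝ) ≤ (m : ℝ) ^ 2 := by nlinarith
      nlinarith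
    have h3 : 3 * π * (m : ℝ) ^ 2 ≤ 3 * π * (m : ℝ) ^ 4 :=
      mul_le_mul_of_nonneg_left hm2 (by positivity)
    have hπ2 : π ^ 2 < 3.15 ^ 2 := by nlinarith [Real.pi_pos]
    have hc30 : 2 * π ^ 2 + 3 * π ≤ 30 := by nlinarith
    have hm4 : 0 ≤ (m : ℝ) ^ 4 := by positivity
    calc 2 * π ^ 2 * (m : ℝ) ^ 4 + 3 * π * (m : ℝ) ^ 2 ≤ 2 * π ^ 2 * (m : ℝ) ^ 4 + 3 * π * (m : ℝ) ^ 4 := by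
          linarith
      _ = (2 * π ^ 2 + 3 * π) * (m : ℝ) ^ 4 := by ring
      _ ≤ 30 * (m : ℝ) ^ 4 := mul_le_mul_of_nonneg_right hc30 hm4
  -- exponential factor
  have h2 : Real.exp (-(π * (m : ℝ) ^ 2 * Real.cos (4 * y))) ≤ Real.exp (-(π / 5 * (m : ℝ) ^ 2)) := by
    apply Real.exp_le_exp.2
    have : π / 5 * (m : ℝ) ^ 2 ≤ π * (m : ℝ) ^ 2 * Real.cos (4 * y) := by
      have h0 : 0 ≤ π * (m : ℝ) ^ 2 := by positivity
      nlinarith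
    linarith
  -- `m⁴ ≤ e^{4(m-1)}`
  have h3 : (m : ℝ) ^ 4 ≤ Real.exp (4 * ((m : ℝ) - 1)) := by
    have h := Real.add_one_le_exp ((m : ℝ) - 1)
    have h' : (m : ℝ) ≤ Real.exp ((m : ℝ) - 1) := by linarith
    calc (m : ℝ) ^ 4 ≤ (Real.exp ((m : ℝ) - 1)) ^ 4 := by gcongr
      _ = Real.exp (4 * ((m : ℝ) - 1)) := by rw [← Real.exp_nat_mul]; norm_num
  -- assemble
  have h4 : 30 * (m : ℝ) ^ 4 * Real.exp (-(π / 5 * (m : ℝ) ^ 2)) ≤ 30 * Real.exp (-4 * (m : ℝ)) := by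
    have h5 : Real.exp (4 * ((m : ℝ) - 1)) * Real.exp (-(π / 5 * (m : ℝ) ^ 2)) ≤ Real.exp (-4 * (m : ℝ)) := by
      rw [← Real.exp_add]
      apply Real.exp_le_exp.2
      nlinarith
    calc 30 * (m : ℝ) ^ 4 * Real.exp (-(π / 5 * (m : ℝ) ^ 2))
        ≤ 30 * Real.exp (4 * ((m : ℝ) - 1)) * Real.exp (-(π / 5 * (m : ℝ) ^ 2)) := by gcongr
      _ = 30 * (Real.exp (4 * ((m : ℝ) - 1)) * Real.exp (-(π / 5 * (m : ℝ) ^ 2))) := by ring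
      _ ≤ 30 * Real.exp (-4 * (m : ℝ)) := by gcongr
  calc (2 * π ^ 2 * (m : ℝ) ^ 4 + 3 * π * (m : ℝ) ^ 2) * Real.exp (-(π * (m : ℝ) ^ 2 * Real.cos (4 * y)))
      ≤ 30 * (m : ℝ) ^ 4 * Real.exp (-(π / 5 * (m : ℝ) ^ 2)) :=
        mul_le_mul h1 h2 (Real.exp_pos _).le (by positivity)
    _ ≤ 30 * Real.exp (-4 * (m : ℝ)) := h4

/-- `e^{-4} ≤ 1/2` and `e^{-52} ≤ 1/38416`. [folklore] -/
theorem exp_neg_four_le : Real.exp (-4) ≤ 1 / 2 ∧ Real.exp (-52) ≤ 1 / 38416 := by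
  constructor
  · rw [Real.exp_neg, inv_eq_one_div, div_le_div_iff₀ (Real.exp_pos _) (by norm_num)]
    have := Real.add_one_le_exp (4:ℝ)
    linarith
  · rw [Real.exp_neg, inv_eq_one_div, div_le_div_iff₀ (Real.exp_pos _) (by norm_num)]
    have h13 : (14 : ℝ) ≤ Real.exp 13 := by
      have := Real.add_one_le_exp (13:ℝ); linarith
    have h52 : Real.exp 52 = (Real.exp 13) ^ 4 := by
      rw [← Real.exp_nat_mul]; norm_num
    have : (14 : ℝ) ^ 4 ≤ (Real.exp 13) ^ 4 := by gcongr
    rw [h52]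
    nlinarith

/-- The tail is absolutely summable and small: `Σ_{j≥0} ‖s_{j+13}(y)‖ ≤ 1/100`. [folklore] -/
theorem tsum_norm_term_tail_le {y : ℝ} (hc : 1 / 5 ≤ Real.cos (4 * y)) :
    Summable (fun j : ℕ ↦ ‖term (j + 13) y‖) ∧ ∑' j : ℕ, ‖term (j + 13) y‖ ≤ 1 / 100 := by
  have hb : ∀ j : ℕ, ‖term (j + 13) y‖ ≤ 30 * Real.exp (-52) * Real.exp (-4) ^ j := by
    intro j
    have h := norm_term_le_of_cos (m := j + 13) (by omega) hc
    have e : 30 * Real.exp (-4 * ((j + 13 : ℕ) : ℝ)) = 30 * Real.exp (-52) * Real.exp (-4) ^ j := by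
      rw [← Real.exp_nat_mul, mul_assoc, ← Real.exp_add]
      congr 1
      push_cast
      ring_nf
    rwa [e] at h
  have hq0 : 0 ≤ Real.exp (-4) := (Real.exp_pos _).le
  have hq1 : Real.exp (-4) < 1 := by linarith [exp_neg_four_le.1]
  have hgeom : Summable (fun j : ℕ ↦ 30 * Real.exp (-52) * Real.exp (-4) ^ j) :=
    (summable_geometric_of_lt_one hq0 hq1).mul_left _
  have hs : Summable (fun j : ℕ ↦ ‖term (j + 13) y‖) :=
    Summable.of_nonneg_of_le (fun _ ↦ norm_nonneg _) hb hgeom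
  refine ⟨hs, ?_⟩
  obtain ⟨e4, e52⟩ := exp_neg_four_le
  calc ∑' j : ℕ, ‖term (j + 13) y‖ ≤ ∑' j : ℕ, 30 * Real.exp (-52) * Real.exp (-4) ^ j :=
        Summable.tsum_le_tsum hb hs hgeom
    _ = 30 * Real.exp (-52) * (1 - Real.exp (-4))⁻¹ := by
        rw [tsum_mul_left, tsum_geometric_of_lt_one hq0 hq1]
    _ ≤ 30 * (1 / 38416) * 2 := by
        have hinv : (1 - Real.exp (-4))⁻¹ ≤ 2 := by
          rw [inv_eq_one_div, div_le_iff₀ (by linarith)]; linarith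
        have h30 : 0 ≤ 30 * Real.exp (-52) := by positivity
        calc 30 * Real.exp (-52) * (1 - Real.exp (-4))⁻¹ ≤ 30 * Real.exp (-52) * 2 :=
              mul_le_mul_of_nonneg_left hinv h30
          _ ≤ 30 * (1 / 38416) * 2 := by nlinarith
    _ ≤ 1 / 100 := by norm_num

/-- The whole series `Σ_{n≥0} s_{n+1}(y)` converges when `cos 4y ≥ 1/5`. [folklore] -/
theorem summable_term {y : ℝ} (hc : 1 / 5 ≤ Real.cos (4 * y)) :
    Summable (fun n : ℕ ↦ term (n + 1) y) := by
  have h := (tsum_norm_term_tail_le hc).1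
  have h' : Summable (fun j : ℕ ↦ term (j + 12 + 1) y) := Summable.of_norm (by simpa using h)
  exact (summable_nat_add_iff 12).1 h'

/-- **Sign of `Re Φ_ℂ(iy)` from the certificate (positive case).** [folklore] -/
theorem re_tsum_term_pos {q : ℚ} (h : checkPos q = true) :
    0 < (∑' n : ℕ, term (n + 1) (q : ℝ)).re := by
  obtain ⟨hc, hhead⟩ := checkPos_sound h
  obtain ⟨hsn, htail⟩ := tsum_norm_term_tail_le hc
  have hs := summable_term hc
  rw [← hs.sum_add_tsum_nat_add 12, Complex.add_re]
  have hsn' : Summable (fun n : ℕ ↦ ‖term (n + 12 + 1) (q : ℝ)‖) := by simpa using hsn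
  have ht : |(∑' n : ℕ, term (n + 12 + 1) (q : ℝ)).re| ≤ 1 / 100 :=
    calc |(∑' n : ℕ, term (n + 12 + 1) (q : ℝ)).re| ≤ ‖∑' n : ℕ, term (n + 12 + 1) (q : ℝ)‖ :=
          Complex.abs_re_le_norm _
      _ ≤ ∑' n : ℕ, ‖term (n + 12 + 1) (q : ℝ)‖ := norm_tsum_le_tsum_norm hsn'
      _ = ∑' j : ℕ, ‖term (j + 13) (q : ℝ)‖ := by simp
      _ ≤ 1 / 100 := htail
  linarith [neg_abs_le (∑' n : ℕ, term (n + 12 + 1) (q : ℝ)).re]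

/-- **Sign of `Re Φ_ℂ(iy)` from the certificate (negative case).** [folklore] -/
theorem re_tsum_term_neg {q : ℚ} (h : checkNeg q = true) :
    (∑' n : ℕ, term (n + 1) (q : ℝ)).re < 0 := by
  obtain ⟨hc, hhead⟩ := checkNeg_sound h
  obtain ⟨hsn, htail⟩ := tsum_norm_term_tail_le hc
  have hs := summable_term hc
  rw [← hs.sum_add_tsum_nat_add 12, Complex.add_re]
  have hsn' : Summable (fun n : ℕ ↦ ‖term (n + 12 + 1) (q : ℝ)‖) := by simpa using hsn
  have ht : |(∑' n : ℕ, term (n + 12 + 1) (q : ℝ)).re| ≤ 1 / 100 :=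
    calc |(∑' n : ℕ, term (n + 12 + 1) (q : ℝ)).re| ≤ ‖∑' n : ℕ, term (n + 12 + 1) (q : ℝ)‖ :=
          Complex.abs_re_le_norm _
      _ ≤ ∑' n : ℕ, ‖term (n + 12 + 1) (q : ℝ)‖ := norm_tsum_le_tsum_norm hsn'
      _ = ∑' j : ℕ, ‖term (j + 13) (q : ℝ)‖ := by simp
      _ ≤ 1 / 100 := htail
  linarith [le_abs_self (∑' n : ℕ, term (n + 12 + 1) (q : ℝ)).re]

/-- **`Re Φ_ℂ(0.31 i) > 0`.** [folklore] -/
theorem re_tsum_pos_031 : 0 < (∑' n : ℕ, term (n + 1) ((31 / 100 : ℚ) : ℝ)).re :=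
  re_tsum_term_pos checkPos_031

/-- **`Re Φ_ℂ(0.33 i) < 0`.** [folklore] -/
theorem re_tsum_neg_033 : (∑' n : ℕ, term (n + 1) ((33 / 100 : ℚ) : ℝ)).re < 0 :=
  re_tsum_term_neg checkNeg_033

end UniversalFactor.PhiICert

end Summit.RiemannHypothesis.RiemannHypothesis.Theorems
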